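import Summits.QuantumFields.YangMills.Theorems.BalabanUVNodesK0V23Defs
import Literature.MathematicalPhysics.QuantumFieldTheory.Balaban1983to89.Node00.Record13NumericsOfThm1CCMWZBChi
import Literature.MathematicalPhysics.QuantumFieldTheory.Balaban1983to89.Node00.Record13Ax

/-!
# K0ᴬ (stmt-QuantumFields-27238 `Record13SepCoPHInhabitedAx`) — THE V23 STUB-3 TEXTS RE-CENTRED (OP 5a ∕ H3.3, file «DefsAx» v1): the sign-free |β| box and its LOCATED-K0ε₀ strengthening
# read at the BLOCK-AXIAL β of record `betaOfRecord₁₃Ax` evaluated at def-Y's re-pinned witness `theta13OfThm1CCMWZBAx` — texts + letter doors only (the K0ᴬ body door follows the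
# Ax edition of `…K0AllTorusOfStepTokensGuardedZBLam{,Print}`)

Cell `pub-ymgap` (YM-PLAN Track A, D-0062), width seat `pub-ymgap-dag-n07-w3` (g22; dag-lead g40 HANDS-3 H3.3 «Summits side, piecewise after H3.1 lands: Ax∕χ editions of `…K0V23Defs` …»).
`--supports stmt-QuantumFields-27238 --as helper` (K0ᴬ), COUNT-NEUTRAL.  NEW leaf (body-freeze №460 (2): nothing of `…K0V23Defs` edited; its CENTRE-BLIND texts `Prop8StepCoPGridGBAt`
(stub 1ᴮ) and `K0N09Eps0LetterAt` are REUSED BY NAME, not restated); 0 `sorry` ∕ `instance` ∕ `notation`; standard axioms.  [15] = [Balaban1985Variational]; [I] = [Balaban1987RG1];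
[III] = [Balaban1988Convergent]; [II] = [Balaban1984PropagatorsII].

WHY.  Director-ym №467 (D) ∕ rev 31–32: K0⁷ `Record13SepCoPHInhabited` (stmt-QuantumFields-20541) is banked as an aside and K0ᴬ `Record13SepCoPHInhabitedAx` is its re-centred successor (σ:
`Provisos₁₃SepCoPH ↦ …Ax`, `betaOfRecord₁₃ ↦ betaOfRecord₁₃Ax`, `SlotsNondegenerate₁₃ ↦ …Ax`).  Plan g99's V24 skeleton (`K0Skeleton13SepCoPHAxV24.lean`, H3.5) re-targets V23: stub 1ᴮ
`Prop8StepCoPGridGBAt` is CENTRE-BLIND (this seat's σ-closure census `SIGMA-CLOSURE-K0-V23-Ax.g22.md`: no centred constant in its closure) and stays VERBATIM; stub 3ᴬ′ᴮ's |β| box reads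
`betaOfRecord₁₃ F 2 (theta13OfThm1CCMWZB …)` — centred twice (β-slot χ and the witness's live re-pin, census finding (1)) — and becomes the Ax text below, over def-Y's SAME-ARITY re-pinned
witness `theta13OfThm1CCMWZBAx` (✓ `Node00/Record13NumericsOfThm1CCMWZBChi`) and PT-A-2's `betaOfRecord₁₃Ax` ([Ax-3a]).  Every other byte of the V23 texts is unchanged.
* §1 `AbsBetaBoxAtThm1WitnessCCMGenGridGZBAxAt F` — the V23 3ᴬ′ᴮ text `K0V23Defs.AbsBetaBoxAtThm1WitnessCCMGenGridGZBAt F` with `betaOfRecord₁₃ ↦ betaOfRecord₁₃Ax`, `theta13OfThm1CCMWZB ↦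
  theta13OfThm1CCMWZBAx`; `AbsBetaBoxAtThm1WitnessCCMGenGridGZBEps0AxAt F` — the strengthened text with the LOCATED-K0ε₀ letter `K0N09Eps0LetterAt F a₀ ε₀` conjoined (by name).
* §2 `absBetaBoxGenGridGZBAxAt_of_eps0` (strengthened ⟹ text), `exists_eps0Letter_absBoxAx_of_eps0B` (the letter read off the strengthened output), and the token-blindness display at Ax
  (`betaOfRecord₁₃Ax` at letters `(0, 0)` = at any `(Efl, logz)`, `rfl`).
NOT HERE (next files of H3.3): the K0ᴬ body door `k0BodyAx_of_stub1B_of_2P_of_3B` — it needs the Ax edition of k0-s1-w1's `record13SepCoPHBody_of_stubs1GBPrint_2P_3A'GBPrintZB_lam`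
(`…K0AllTorusOfStepTokensGuardedZBLam{,Print}Ax`, gated on def-Y's module #1 and RR-2's live-selector sockets).

HONEST FRAMING (binding).  Texts and two one-line doors; nothing of Bałaban asserted; the texts are CANDIDATES until plan g99 registers V24 (`ledger skeleton check … --crux stmt-QuantumFields-27238`,
the plan seat's act alone); the LOCATED-K0ε₀ letter stays a displayed hypothesis; K0ᴬ 27238 ∕ K1ᴬ 27239 ∕ K3ᴬ 27247 OPEN; counts unmoved (8∕28 · K 1∕4); R4 = the CONDITIONAL finite-𝕋⁴ rung
`BalabanLadder.UV` only — NOT continuum ∕ ℝ⁴ ∕ OS; the Yang–Mills mass gap (Clay) is NOT proved by any of this.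
-/

noncomputable section

open MeasureTheory
open scoped Matrix.Norms.L2Operator

namespace Summit.QuantumFields.YangMills.Theorems.K0V23DefsAx

open Literature.MathematicalPhysics.QuantumFieldTheory.Balaban1983to89
open Literature.MathematicalPhysics.QuantumFieldTheory.Balaban1983to89.Node00
open Literature.MathematicalPhysics.QuantumFieldTheory.Balaban1983to89.T4Continuum
open Literature.MathematicalPhysics.QuantumFieldTheory.Balaban1983to89.FlowStep
open Literature.MathematicalPhysics.QuantumFieldTheory.Balaban1983to89.B15DeterminingSets
open Summit.QuantumFields.YangMills.Theorems.K0V23Defs (K0N09Eps0LetterAt)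

/-! ## §1. The re-centred stub-3 texts -/

/-- **V24 stub 3ᴬ′ᴮ text, RE-CENTRED** `AbsBetaBoxAtThm1WitnessCCMGenGridGZBAxAt F`: the sign-free |β| box of the BLOCK-AXIAL β of record `betaOfRecord₁₃Ax` at the LETTER-FREE PRINT-REGIME MEMBER
of def-Y's re-pinned Z3 family `theta13OfThm1CCMWZBAx F 2 j (1 / 2) a₀ ε₀ ε₂₉ B₃ B₃' a₀ a₁ (fun _ _ => 0) (fun _ _ => 0)`, from the grid-guarded ᴮ (8)-sentence and ᴮ (9)-token at print's datum —
`K0V23Defs.AbsBetaBoxAtThm1WitnessCCMGenGridGZBAt` with EXACTLY the σ of director-ym №467 (D); NOTHING else changed.  NOT registered by this file.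
[cite: Balaban1985Variational, Thm 1 (8),(9) p.279, (7) p.278; Balaban1984PropagatorsII, (2.3) p.224; Balaban1988Convergent, (2.1) p.254, (2.5) p.255, p.257; Balaban1987RG1, (1.12) p.262, (0.21) p.256, (1.6) p.261, (1.20)–(1.22) p.264, (2.9) p.266] -/
def AbsBetaBoxAtThm1WitnessCCMGenGridGZBAxAt (F : T4Family) : Prop :=
  ∀ (j c c₀ c₁ : ℕ) (B₃ B₃' a₀ a₁ : ℝ), c ≤ F.L ^ j → c₀ ≤ j + 1 → c₁ ≤ j → 2 * (F.L : ℝ) ^ 2 ≤ B₃ → 0 < B₃' → 0 < a₀ → 0 < a₁ →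
    VariationalThm1RegSepCoP7MGB F 2
      (fun ν M g K k _s => c ≤ ν.M₁ ∧ k + c₀ ≤ F.m + K ∧ F.L ^ c₁ ∣ M ∧
        ∀ i, 1 ≤ i → i ≤ k → dCubeSide (F.P K).L M (RkOfRecord (F.P K).L ν.r (g i)) i ∣ (F.P K).sitesPerDir 0) (lamDatum F) (dataSmall7LamTopOf F 2) B₃ a₀ a₁ →
    Gauge9RegSepTopStepGB F 2 (fun ν K Ω => suppDomOfRecord F ν K Ω) (F.L ^ j)
      (fun ν M g K k _s => c ≤ ν.M₁ ∧ k + c₀ ≤ F.m + K ∧ F.L ^ c₁ ∣ M ∧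
        ∀ i, 1 ≤ i → i ≤ k → dCubeSide (F.P K).L M (RkOfRecord (F.P K).L ν.r (g i)) i ∣ (F.P K).sitesPerDir 0) (lamDatum F) (dataSmall7LamTopOf F 2) B₃ B₃' a₀ a₁ →
    ∃ γ₀ ε₀ ε₂₉ β' : ℝ, 0 < γ₀ ∧ 0 < ε₀ ∧ 0 < ε₂₉ ∧
      BetaLowerH (-β') γ₀ (betaOfRecord₁₃Ax F 2 (theta13OfThm1CCMWZBAx F 2 j (1 / 2) a₀ ε₀ ε₂₉ B₃ B₃' a₀ a₁ (fun _ _ => 0) (fun _ _ => 0))) ∧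
      BetaUpperH β' γ₀ (betaOfRecord₁₃Ax F 2 (theta13OfThm1CCMWZBAx F 2 j (1 / 2) a₀ ε₀ ε₂₉ B₃ B₃' a₀ a₁ (fun _ _ => 0) (fun _ _ => 0)))

/-- **THE STRENGTHENED RE-CENTRED 3ᴬ′ᴮ TEXT «WITH LOCATED-K0ε₀»**: §1's text with the letter `K0V23Defs.K0N09Eps0LetterAt F a₀ ε₀` (`2·a₀ ≤ ε₀·L²`, by NAME) conjoined to the ∃-output.
NOT registered; NOT asserted. [cite: Balaban1985Variational, Thm 1 (8),(9) p.279; Balaban1987RG1, Thm 1 p.259, (1.2) p.260, (1.20)–(1.22) p.264; Balaban1988Convergent, (2.1) p.254, (2.5) p.255] -/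
def AbsBetaBoxAtThm1WitnessCCMGenGridGZBEps0AxAt (F : T4Family) : Prop :=
  ∀ (j c c₀ c₁ : ℕ) (B₃ B₃' a₀ a₁ : ℝ), c ≤ F.L ^ j → c₀ ≤ j + 1 → c₁ ≤ j → 2 * (F.L : ℝ) ^ 2 ≤ B₃ → 0 < B₃' → 0 < a₀ → 0 < a₁ →
    VariationalThm1RegSepCoP7MGB F 2
      (fun ν M g K k _s => c ≤ ν.M₁ ∧ k + c₀ ≤ F.m + K ∧ F.L ^ c₁ ∣ M ∧
        ∀ i, 1 ≤ i → i ≤ k → dCubeSide (F.P K).L M (RkOfRecord (F.P K).L ν.r (g i)) i ∣ (F.P K).sitesPerDir 0) (lamDatum F) (dataSmall7LamTopOf F 2) B₃ a₀ a₁ →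
    Gauge9RegSepTopStepGB F 2 (fun ν K Ω => suppDomOfRecord F ν K Ω) (F.L ^ j)
      (fun ν M g K k _s => c ≤ ν.M₁ ∧ k + c₀ ≤ F.m + K ∧ F.L ^ c₁ ∣ M ∧
        ∀ i, 1 ≤ i → i ≤ k → dCubeSide (F.P K).L M (RkOfRecord (F.P K).L ν.r (g i)) i ∣ (F.P K).sitesPerDir 0) (lamDatum F) (dataSmall7LamTopOf F 2) B₃ B₃' a₀ a₁ →
    ∃ γ₀ ε₀ ε₂₉ β' : ℝ, 0 < γ₀ ∧ 0 < ε₀ ∧ 0 < ε₂₉ ∧ K0N09Eps0LetterAt F a₀ ε₀ ∧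
      BetaLowerH (-β') γ₀ (betaOfRecord₁₃Ax F 2 (theta13OfThm1CCMWZBAx F 2 j (1 / 2) a₀ ε₀ ε₂₉ B₃ B₃' a₀ a₁ (fun _ _ => 0) (fun _ _ => 0))) ∧
      BetaUpperH β' γ₀ (betaOfRecord₁₃Ax F 2 (theta13OfThm1CCMWZBAx F 2 j (1 / 2) a₀ ε₀ ε₂₉ B₃ B₃' a₀ a₁ (fun _ _ => 0) (fun _ _ => 0)))

/-! ## §2. Letter doors (count-neutral) -/

/-- The strengthened re-centred text implies the re-centred V24 text at `F` (drop the letter). [cite: Balaban1987RG1, §1 p.264 (bookkeeping)] -/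
theorem absBetaBoxGenGridGZBAxAt_of_eps0 (F : T4Family) (h : AbsBetaBoxAtThm1WitnessCCMGenGridGZBEps0AxAt F) : AbsBetaBoxAtThm1WitnessCCMGenGridGZBAxAt F :=
  fun j c c₀ c₁ B₃ B₃' a₀ a₁ hc hc₀ hc₁ hB₃ hB₃' ha₀ ha₁ h15 h9 => by
    obtain ⟨γ₀, ε₀, ε₂₉, β', hγ₀, hε₀, hε₂₉, -, hlow, hup⟩ := h j c c₀ c₁ B₃ B₃' a₀ a₁ hc hc₀ hc₁ hB₃ hB₃' ha₀ ha₁ h15 h9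
    exact ⟨γ₀, ε₀, ε₂₉, β', hγ₀, hε₀, hε₂₉, hlow, hup⟩

/-- The letter READ OFF the strengthened re-centred output at a door. [cite: Balaban1987RG1, Thm 1 p.259, (1.2) p.260 (bookkeeping)] -/
theorem exists_eps0Letter_absBoxAx_of_eps0B (F : T4Family) (h : AbsBetaBoxAtThm1WitnessCCMGenGridGZBEps0AxAt F) (j c c₀ c₁ : ℕ) (B₃ B₃' a₀ a₁ : ℝ)
    (hc : c ≤ F.L ^ j) (hc₀ : c₀ ≤ j + 1) (hc₁ : c₁ ≤ j) (hB₃ : 2 * (F.L : ℝ) ^ 2 ≤ B₃) (hB₃' : 0 < B₃') (ha₀ : 0 < a₀) (ha₁ : 0 < a₁)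
    (h15 : VariationalThm1RegSepCoP7MGB F 2
      (fun ν M g K k _s => c ≤ ν.M₁ ∧ k + c₀ ≤ F.m + K ∧ F.L ^ c₁ ∣ M ∧
        ∀ i, 1 ≤ i → i ≤ k → dCubeSide (F.P K).L M (RkOfRecord (F.P K).L ν.r (g i)) i ∣ (F.P K).sitesPerDir 0) (lamDatum F) (dataSmall7LamTopOf F 2) B₃ a₀ a₁)
    (h9 : Gauge9RegSepTopStepGB F 2 (fun ν K Ω => suppDomOfRecord F ν K Ω) (F.L ^ j)
      (fun ν M g K k _s => c ≤ ν.M₁ ∧ k + c₀ ≤ F.m + K ∧ F.L ^ c₁ ∣ M ∧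
        ∀ i, 1 ≤ i → i ≤ k → dCubeSide (F.P K).L M (RkOfRecord (F.P K).L ν.r (g i)) i ∣ (F.P K).sitesPerDir 0) (lamDatum F) (dataSmall7LamTopOf F 2) B₃ B₃' a₀ a₁) :
    ∃ γ₀ ε₀ ε₂₉ β' : ℝ, 0 < γ₀ ∧ 0 < ε₀ ∧ 0 < ε₂₉ ∧ 2 * a₀ ≤ ε₀ * (F.L : ℝ) ^ 2 ∧
      BetaLowerH (-β') γ₀ (betaOfRecord₁₃Ax F 2 (theta13OfThm1CCMWZBAx F 2 j (1 / 2) a₀ ε₀ ε₂₉ B₃ B₃' a₀ a₁ (fun _ _ => 0) (fun _ _ => 0))) ∧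
      BetaUpperH β' γ₀ (betaOfRecord₁₃Ax F 2 (theta13OfThm1CCMWZBAx F 2 j (1 / 2) a₀ ε₀ ε₂₉ B₃ B₃' a₀ a₁ (fun _ _ => 0) (fun _ _ => 0))) :=
  h j c c₀ c₁ B₃ B₃' a₀ a₁ hc hc₀ hc₁ hB₃ hB₃' ha₀ ha₁ h15 h9

/-- 3ᴬ′ᴮ-Ax display (kernel, `rfl`): the re-centred β the letter-free text boxes IS the re-centred β of the member at ANY letters `(Efl, logz)` (the block-axial β reads the witness only through
`toStage8Params`, `ν` and `ε₂₉`, none of which the letters move) — so a door's section letters unify with the letter-free texts. [cite: Balaban1987RG1, (1.6) p.261, (1.20)–(1.22) p.264, (2.9) p.266 (bookkeeping)] -/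
example (F : T4Family) (j : ℕ) (ε₀ ε₂₉ B₃ B₃' a₀ a₁ : ℝ) (Efl logz : B12.RunParams → ℕ → ℝ) :
    betaOfRecord₁₃Ax F 2 (theta13OfThm1CCMWZBAx F 2 j (1 / 2) a₀ ε₀ ε₂₉ B₃ B₃' a₀ a₁ (fun _ _ => 0) (fun _ _ => 0)) =
      betaOfRecord₁₃Ax F 2 (theta13OfThm1CCMWZBAx F 2 j (1 / 2) a₀ ε₀ ε₂₉ B₃ B₃' a₀ a₁ Efl logz) := rfl

end Summit.QuantumFields.YangMills.Theorems.K0V23DefsAx
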